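import Summits.HubbardSuperconductivity.HubbardSuperconductivity.Theorems.AnisotropyChordTransferFibre3FinXCEval
import Summits.HubbardSuperconductivity.HubbardSuperconductivity.Theorems.AnisotropyChordTransferFibre3FinXBCert

/-!
# Route `AnisotropyChord` / H0 rotor rung: FIN small-`L` row-C evaluator — soundness of the real-space sums

Soundness layer 1 of `…Fibre3FinXCEval` on a checked λ-cell for the ground profile (`f = groundF L λ₂`, even, swap- and
x-mirror-symmetric): the four-direction gradients `gradAt` (g4 `mem_cellOracle4` + index maps, `ground_swap`), the sup bound
`xcMok`, `xcQ0` (`Q₀`), `xcRbar` (`R̄`), `xcX` (`X`), `xcPsi` (`Ψ`), `xcC0x`/`xcRowSum` (`Σ_{b∉{0,x̂}} C0(x̂,b)²` via p1's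
`c0Explicit_holds`), natural-coordinate forms of `IsNN`, `InD`, `Rwt`.  The brackets `Chi`, `Nhi`, `T⁺` and the cell certificate are
`…Fibre3FinXCCert`.
Prover seat `hubbard-h0-rotor-p3` g5; helper for piece A = stmt-HubbardSuperconductivity-23918 of rung 19089 (`--supports`, helper
class).  WHAT THIS IS NOT: nothing here proves superconductivity in the Hubbard model (rotor TARGET as worded stays FALSE, g15 verdict);
soundness lemmas for the FIN certificates of ONE conditional reduction.  Tree imports only; no sorry, no new axioms.
-/

set_option linter.dupNamespace false
set_option autoImplicit false

namespace Summit.HubbardSuperconductivity.HubbardSuperconductivity.Theorems.AnisotropyChord.Transfer.Fibre3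

namespace FinXB

open scoped BigOperators
open Finset Hole2 FinCell

variable {L : ℕ} [NeZero L]

/-! ## Natural coordinates -/

/-- shorthand: the natural momentum / site `(r₁, r₂)`. -/
def np (L : ℕ) (r1 r2 : ℕ) : Tor L := ((((r1 : ℕ) : ZMod L)), (((r2 : ℕ) : ZMod L)))

omit [NeZero L] in
/-- casts below `L` are injective. [folklore] -/
theorem natCast_eq_iff {i j : ℕ} (hi : i < L) (hj : j < L) : ((i : ℕ) : ZMod L) = ((j : ℕ) : ZMod L) ↔ i = j := by
  constructor
  · intro h
    have := (ZMod.natCast_eq_natCast_iff' i j L).mp h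
    rwa [Nat.mod_eq_of_lt hi, Nat.mod_eq_of_lt hj] at this
  · rintro rfl; rfl

omit [NeZero L] in
/-- `−1 = L − 1` in `ZMod L`. [folklore] -/
theorem neg_one_eq_cast (hL : 1 ≤ L) : (-1 : ZMod L) = (((L - 1 : ℕ)) : ZMod L) := by
  rw [Nat.cast_sub hL, Nat.cast_one, ZMod.natCast_self, zero_sub]

omit [NeZero L] in
/-- `ex`, `ey` and their negatives at natural coordinates. [folklore] -/
theorem ex_eq [NeZero L] (hL : 3 ≤ L) : ex L = np L 1 0 ∧ -ex L = np L (L - 1) 0 ∧ ey L = np L 0 1 ∧ -ey L = np L 0 (L - 1) := by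
  have h1 := neg_one_eq_cast (L := L) (by omega)
  unfold ex ey np
  refine ⟨?_, ?_, ?_, ?_⟩
  · simp
  · rw [Prod.neg_mk, neg_zero, h1]; simp
  · simp
  · rw [Prod.neg_mk, neg_zero, h1]; simp

/-- `eDir j` at natural coordinates. [folklore] -/
theorem eDir_eq (hL : 3 ≤ L) {j : ℕ} (hj : j < 4) :
    eDir L j = if j = 0 then np L 1 0 else if j = 1 then np L (L - 1) 0 else if j = 2 then np L 0 1 else np L 0 (L - 1) := by
  obtain ⟨h0, h1, h2, h3⟩ := ex_eq (L := L) hL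
  unfold eDir
  interval_cases j
  · simpa using h0
  · simpa using h1
  · simpa using h2
  · simpa using h3

omit [NeZero L] in
/-- `IsNN` at natural coordinates. [folklore] -/
theorem isNN_np [NeZero L] (hL : 3 ≤ L) {r1 r2 : ℕ} (h1 : r1 < L) (h2 : r2 < L) :
    IsNN L (np L r1 r2) = true ↔
      ((r1 = 1 ∧ r2 = 0) ∨ (r1 = L - 1 ∧ r2 = 0) ∨ (r1 = 0 ∧ r2 = 1) ∨ (r1 = 0 ∧ r2 = L - 1)) := by
  have hneg := neg_one_eq_cast (L := L) (by omega)
  have hL1 : 1 < L := by omega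
  have hLm : L - 1 < L := by omega
  have hL0 : 0 < L := by omega
  unfold IsNN np
  rw [hneg]
  simp only [Bool.or_eq_true, decide_eq_true_eq, Prod.mk.injEq]
  rw [← Nat.cast_one, ← Nat.cast_zero (R := ZMod L), natCast_eq_iff h1 hL1, natCast_eq_iff h2 hL0, natCast_eq_iff h1 hLm,
    natCast_eq_iff h1 hL0, natCast_eq_iff h2 hL1, natCast_eq_iff h2 hLm]
  tauto

omit [NeZero L] in
/-- the zero site at natural coordinates. [folklore] -/
theorem np_eq_zero [NeZero L] {r1 r2 : ℕ} (h1 : r1 < L) (h2 : r2 < L) : np L r1 r2 = 0 ↔ (r1 = 0 ∧ r2 = 0) := by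
  unfold np
  rw [Prod.mk_eq_zero, natCast_zmod_eq_zero L h1, natCast_zmod_eq_zero L h2]

/-- the regular-site test at natural coordinates. [folklore] -/
theorem isRegN_iff (hL : 3 ≤ L) {r1 r2 : ℕ} (h1 : r1 < L) (h2 : r2 < L) :
    isRegN L r1 r2 = true ↔ IsReg L (np L r1 r2) := by
  unfold IsReg
  rw [Ne, np_eq_zero h1 h2, Bool.eq_false_iff, ne_eq, isNN_np hL h1 h2]
  simp only [isRegN, Bool.not_eq_true', Bool.eq_false_iff, ne_eq, Bool.or_eq_true, Bool.and_eq_true, beq_iff_eq]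
  tauto

/-- the core test `a ∉ {0, x̂}` at natural coordinates. [folklore] -/
theorem notCore_iff (hL : 3 ≤ L) {r1 r2 : ℕ} (h1 : r1 < L) (h2 : r2 < L) :
    notCore r1 r2 = true ↔ (np L r1 r2 ≠ 0 ∧ np L r1 r2 ≠ ex L) := by
  rw [Ne, np_eq_zero h1 h2, (ex_eq (L := L) hL).1]
  unfold np
  rw [Ne, Prod.mk.injEq, natCast_eq_iff h1 (by omega : 1 < L), natCast_eq_iff h2 (by omega : 0 < L)]
  simp only [notCore, Bool.not_eq_true', Bool.eq_false_iff, ne_eq, Bool.or_eq_true, Bool.and_eq_true, beq_iff_eq]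
  tauto

/-! ## Gradients in the four directions -/

omit [NeZero L] in
/-- `D_{−x̂} f(x,y) = −D_{x̂} f(x+1, y)`. [folklore] -/
theorem Dgrad_negx [NeZero L] (f : Tor L → ℝ) (x y : ZMod L) :
    Dgrad L f (-ex L) (x, y) = -Dgrad L f (ex L) (x + 1, y) := by
  unfold Dgrad ex
  simp only [Prod.neg_mk, neg_zero, Prod.mk_sub_mk, sub_neg_eq_add, sub_zero, add_sub_cancel_right]
  ring

omit [NeZero L] in
/-- `D_ŷ f(x,y) = D_{x̂} f(y,x)` for a swap-symmetric `f`. [folklore] -/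
theorem Dgrad_ey_swap [NeZero L] {f : Tor L → ℝ} (hsw : ∀ r : Tor L, f (r.2, r.1) = f r) (x y : ZMod L) :
    Dgrad L f (ey L) (x, y) = Dgrad L f (ex L) (y, x) := by
  have e1 : f (x, y) = f (y, x) := by simpa using hsw (y, x)
  have e2 : f (x, y - 1) = f (y - 1, x) := by simpa using hsw (y - 1, x)
  unfold Dgrad ex ey
  simp only [Prod.mk_sub_mk, sub_zero]
  rw [e1, e2]

omit [NeZero L] in
/-- `D_{−ŷ} f(x,y) = −D_{x̂} f(y+1,x)` for a swap-symmetric `f`. [folklore] -/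
theorem Dgrad_negy_swap [NeZero L] {f : Tor L → ℝ} (hsw : ∀ r : Tor L, f (r.2, r.1) = f r) (x y : ZMod L) :
    Dgrad L f (-ey L) (x, y) = -Dgrad L f (ex L) (y + 1, x) := by
  have e1 : f (x, y) = f (y, x) := by simpa using hsw (y, x)
  have e3 : f (x, y + 1) = f (y + 1, x) := by simpa using hsw (y + 1, x)
  unfold Dgrad ex ey
  simp only [Prod.neg_mk, neg_zero, Prod.mk_sub_mk, sub_neg_eq_add, sub_zero, add_sub_cancel_right]
  rw [e1, e3]; ring

/-- ★ `D_e f` from the `x̂`-gradient table for the ground profile (swap symmetry), all four directions. [folklore] -/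
theorem mem_gradAt (hL : 5 ≤ L) {Δ lam2 : ℝ} (hΔ0 : 0 ≤ Δ) (hΔ1 : Δ < 1) {f : Tor L → ℝ} (hf : IsGroundTwoMagnon L Δ lam2 f)
    {la lb : ℤ} (hla : (la : ℝ) ≤ lam2 * ((D : ℤ) : ℝ)) (hlb : lam2 * ((D : ℤ) : ℝ) ≤ (lb : ℝ))
    (hchk : groundCellCheck L la lb = true) {j : ℕ} (hj : j < 4) {r1 r2 : ℕ} (h1 : r1 < L) (h2 : r2 < L) :
    mem (Dgrad L f (eDir L j) (np L r1 r2)) (gradAt L (gTab4 L la lb) j r1 r2) := by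
  have hL3 : 3 ≤ L := by omega
  have hL0 : 0 < L := by omega
  have hlam : 0 < lam2 := lam2_pos L hL3 hΔ1 hf.1
  have hfe : f = groundF L lam2 := ground_eq_explicit L (by omega) hΔ0 hΔ1 hf
  have hsw : ∀ r : Tor L, f (r.2, r.1) = f r := fun r => by rw [hfe]; exact groundF_swap lam2 r
  -- the `x̂` table
  have hx : ∀ a b : ℕ, a < L → b < L →
      mem (Dgrad L f (ex L) ((((a : ℕ) : ZMod L)), (((b : ℕ) : ZMod L)))) (getF (gTab4 L la lb) a b) := by
    intro a b ha hb
    have h := mem_cellOracle4 (L := L) hL3 hlam hla hlb hchk 1 0 a b (by omega) hL0 ha hb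
    unfold cellOracle4 dOracle4 at h
    rw [hfe]
    unfold ex
    simpa using h
  have hr1' : (r1 + 1) % L < L := Nat.mod_lt _ hL0
  have hr2' : (r2 + 1) % L < L := Nat.mod_lt _ hL0
  have hc1 : ((((r1 + 1) % L : ℕ)) : ZMod L) = ((r1 : ℕ) : ZMod L) + 1 := by
    rw [ZMod.natCast_mod]; push_cast; ring
  have hc2 : ((((r2 + 1) % L : ℕ)) : ZMod L) = ((r2 : ℕ) : ZMod L) + 1 := by
    rw [ZMod.natCast_mod]; push_cast; ring
  unfold gradAt np
  interval_cases j
  · -- `x̂`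
    have e : eDir L 0 = ex L := rfl
    rw [e]; simpa using hx r1 r2 h1 h2
  · -- `−x̂`
    have e : eDir L 1 = -ex L := rfl
    rw [e, Dgrad_negx]
    have h := mem_ineg (hx _ _ hr1' h2)
    rw [hc1] at h
    simpa using h
  · -- `ŷ`
    have e : eDir L 2 = ey L := rfl
    rw [e, Dgrad_ey_swap hsw]
    simpa using hx r2 r1 h2 h1
  · -- `−ŷ`
    have e : eDir L 3 = -ey L := rfl
    rw [e, Dgrad_negy_swap hsw]
    have h := mem_ineg (hx _ _ hr2' h1)
    rw [hc2] at h
    simpa using h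

/-! ## The sup bound and the real-space sums -/

/-- every site is a natural site. [folklore] -/
theorem eq_np (r : Tor L) : r = np L r.1.val r.2.val := by
  unfold np; ext <;> simp

/-- ★ `xcMok` bounds `sup |f|`. [folklore] -/
theorem abs_le_of_xcMok {f : Tor L → ℝ} {ft : List (List Iv)} (hft : TabEncl L f ft) {Mz : ℤ}
    (h : xcMok L ft Mz = true) (r : Tor L) : |f r| ≤ (Mz : ℝ) / ((D : ℤ) : ℝ) := by
  have hD := D_pos
  have h1 : r.1.val < L := ZMod.val_lt _
  have h2 : r.2.val < L := ZMod.val_lt _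
  rw [eq_np r]
  obtain ⟨hlo, hhi⟩ := hft r.1.val r.2.val h1 h2
  unfold xcMok at h
  rw [List.all_eq_true] at h
  have h' := h r.1.val (List.mem_range.mpr h1)
  rw [List.all_eq_true] at h'
  have h'' := h' r.2.val (List.mem_range.mpr h2)
  rw [Bool.and_eq_true, decide_eq_true_eq, decide_eq_true_eq] at h''
  obtain ⟨ha, hb⟩ := h''
  have ha' : -(((getF ft r.1.val r.2.val).1 : ℤ) : ℝ) ≤ (Mz : ℝ) := by exact_mod_cast ha
  have hb' : (((getF ft r.1.val r.2.val).2 : ℤ) : ℝ) ≤ (Mz : ℝ) := by exact_mod_cast hb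
  rw [le_div_iff₀ hD]
  unfold np
  have e : |f ((((r.1.val : ℕ) : ZMod L)), (((r.2.val : ℕ) : ZMod L)))| * ((D : ℤ) : ℝ)
      = |f ((((r.1.val : ℕ) : ZMod L)), (((r.2.val : ℕ) : ZMod L))) * ((D : ℤ) : ℝ)| := by
    rw [abs_mul, abs_of_pos hD]
  rw [e, abs_le]
  constructor <;> linarith

/-- ★ `Q₀ ∈ xcQ0`. [folklore] -/
theorem mem_xcQ0 {f : Tor L → ℝ} {ft : List (List Iv)} (hft : TabEncl L f ft) : mem (Q0 L f) (xcQ0 L ft) := by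
  unfold Q0 xcQ0
  rw [sum_tor_range]
  refine mem_psum _ _ L fun r1 h1 => mem_psum _ _ L fun r2 h2 => ?_
  have e : f ((((r1 : ℕ) : ZMod L)), (((r2 : ℕ) : ZMod L))) ^ 4 = (f ((((r1 : ℕ) : ZMod L)), (((r2 : ℕ) : ZMod L))) ^ 2) ^ 2 := by
    ring
  rw [e]
  exact mem_isqP (mem_isqP (hft r1 r2 h1 h2))

/-- the regular weight at a natural site off the core is the squared `x̂`-gradient of `f`. [folklore] -/
theorem Rwt_np (hL : 3 ≤ L) {Δ : ℝ} {f : Tor L → ℝ} {r1 r2 : ℕ} (h1 : r1 < L) (h2 : r2 < L) :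
    Rwt L Δ f (np L r1 r2) = if notCore r1 r2 then Dgrad L f (ex L) (np L r1 r2) ^ 2 else 0 := by
  have hc := notCore_iff (L := L) hL h1 h2
  unfold Rwt
  by_cases hn : notCore r1 r2 = true
  · obtain ⟨ha, hb⟩ := hc.mp hn
    have hK : K1 L = ex L := rfl
    rw [if_pos hn, if_neg (by rw [hK]; push Not; exact ⟨ha, hb⟩)]
    unfold gradx sfun Dgrad
    have hb' : np L r1 r2 - K1 L ≠ 0 := by rw [hK]; exact sub_ne_zero.mpr hb
    rw [if_neg ha, if_neg hb', hK]
    ring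
  · rw [if_neg hn]
    have : ¬ (np L r1 r2 ≠ 0 ∧ np L r1 r2 ≠ ex L) := fun h => hn (hc.mpr h)
    push Not at this
    have hK : K1 L = ex L := rfl
    rw [if_pos]
    rw [hK]
    by_cases h0 : np L r1 r2 = 0
    · exact Or.inl h0
    · exact Or.inr (this h0)

/-- ★ `R̄ ∈ xcRbar` (any table enclosing the `x̂`-gradient). [folklore] -/
theorem mem_xcRbar (hL : 3 ≤ L) {Δ : ℝ} {f : Tor L → ℝ} {gx : List (List Iv)}
    (hgx : ∀ r1 r2 : ℕ, r1 < L → r2 < L → mem (Dgrad L f (ex L) (np L r1 r2)) (getF gx r1 r2)) :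
    mem (Rbar L Δ f) (xcRbar L gx) := by
  unfold Rbar xcRbar
  rw [sum_tor_range]
  refine mem_psum _ _ L fun r1 h1 => mem_psum _ _ L fun r2 h2 => ?_
  have e := Rwt_np (L := L) hL (Δ := Δ) (f := f) h1 h2
  unfold np at e
  rw [e]
  by_cases hn : notCore r1 r2 = true
  · rw [if_pos hn]; simp only [hn, if_true]; exact mem_isqP (hgx r1 r2 h1 h2)
  · rw [if_neg hn]; simp only [hn]; exact mem_zero

omit [NeZero L] in
/-- the shifted cosine: `cos(2π(r₁ − 1)/L) = cos(2π((r₁ + L − 1) mod L)/L)`. [folklore] -/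
theorem cos_shift_pred (hL : 1 ≤ L) (r1 : ℕ) :
    Real.cos (2 * Real.pi * ((r1 : ℝ) - 1) / L) = Real.cos (2 * Real.pi * (((r1 + (L - 1)) % L : ℕ) : ℝ) / L) := by
  have hL0 : 0 < L := by omega
  have hLr : (L : ℝ) ≠ 0 := by exact_mod_cast (ne_of_gt hL0)
  rw [← cos_mod L hL0]
  have e : 2 * Real.pi * (((r1 + (L - 1) : ℕ)) : ℝ) / L = 2 * Real.pi * ((r1 : ℝ) - 1) / L + 2 * Real.pi := by
    rw [Nat.cast_add, Nat.cast_sub hL]; push_cast; field_simp; ring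
  rw [e, Real.cos_add_two_pi]

/-- ★ `X ∈ xcX`. [folklore] -/
theorem mem_xcX (hL : 3 ≤ L) {Δ : ℝ} {f : Tor L → ℝ} {gx : List (List Iv)}
    (hgx : ∀ r1 r2 : ℕ, r1 < L → r2 < L → mem (Dgrad L f (ex L) (np L r1 r2)) (getF gx r1 r2)) :
    mem (Xmom L Δ f) (xcX L gx (cosTab L)) := by
  have hL0 : 0 < L := by omega
  unfold Xmom xcX
  rw [sum_tor_range]
  refine mem_psum _ _ L fun r1 h1 => mem_psum _ _ L fun r2 h2 => ?_
  have e := Rwt_np (L := L) hL (Δ := Δ) (f := f) h1 h2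
  unfold np at e
  rw [e]
  have hv : ((((r1 : ℕ) : ZMod L), ((r2 : ℕ) : ZMod L)) : Tor L).1.val = r1 := by
    simp only [ZMod.val_natCast, Nat.mod_eq_of_lt h1]
  rw [hv, cos_shift_pred (by omega) r1]
  have hidx : (r1 + (L - 1)) % L < L := Nat.mod_lt _ hL0
  by_cases hn : notCore r1 r2 = true
  · rw [if_pos hn]; simp only [hn, if_true]
    rw [getIv_cosTab hidx]
    exact mem_imul (mem_isqP (hgx r1 r2 h1 h2)) (mem_isub mem_one (mem_cosIv hL hidx))
  · rw [if_neg hn]; simp only [hn]; rw [zero_mul]; exact mem_zero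

/-- the nearest neighbours are `IsNN`. [folklore] -/
theorem isNN_eDir (j : ℕ) : IsNN L (eDir L j) = true := by
  have hm := eDir_mem L j
  unfold IsNN
  unfold nnList at hm
  simp only [List.mem_cons, List.not_mem_nil, or_false] at hm
  simp only [Bool.or_eq_true, decide_eq_true_eq]
  tauto

/-- ★ `Ψ ∈ xcPsi` for the ground profile. [folklore] -/
theorem mem_xcPsi (hL : 5 ≤ L) {Δ lam2 : ℝ} (hΔ0 : 0 ≤ Δ) (hΔ1 : Δ < 1) {f : Tor L → ℝ} (hf : IsGroundTwoMagnon L Δ lam2 f)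
    {la lb : ℤ} (hla : (la : ℝ) ≤ lam2 * ((D : ℤ) : ℝ)) (hlb : lam2 * ((D : ℤ) : ℝ) ≤ (lb : ℝ))
    (hchk : groundCellCheck L la lb = true) :
    mem (PsiSum L Δ f) (xcPsi L (gTab4 L la lb)) := by
  classical
  have hL3 : 3 ≤ L := by omega
  unfold PsiSum xcPsi
  rw [nnList_sum_range]
  refine mem_psum _ _ 4 fun j hj => ?_
  rw [nnList_sum_range]
  refine mem_psum _ _ 4 fun j' hj' => mem_isqP ?_
  unfold psiCorr xcPsiPair
  rw [Finset.sum_filter, sum_tor_range]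
  refine mem_psum _ _ L fun r1 h1 => mem_psum _ _ L fun r2 h2 => ?_
  have hreg := isRegN_iff (L := L) hL3 h1 h2
  unfold np at hreg
  by_cases hr : isRegN L r1 r2 = true
  · have hR := hreg.mp hr
    rw [if_pos hR]; simp only [hr, if_true]
    obtain ⟨h0, hnn⟩ := hR
    -- `D_e s = −D_e f` at a regular site
    have hds : ∀ {i : ℕ}, i < 4 → Dgrad L (sfun' L Δ f) (eDir L i) ((((r1 : ℕ) : ZMod L), ((r2 : ℕ) : ZMod L)))
        = -Dgrad L f (eDir L i) ((((r1 : ℕ) : ZMod L), ((r2 : ℕ) : ZMod L))) := by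
      intro i hi
      have hne : ((((r1 : ℕ) : ZMod L), ((r2 : ℕ) : ZMod L)) : Tor L) - eDir L i ≠ 0 := by
        intro h
        rw [sub_eq_zero] at h
        rw [h, isNN_eDir i] at hnn
        exact Bool.noConfusion hnn
      unfold Dgrad sfun'
      rw [if_neg h0, if_neg hne]; ring
    rw [hds hj, hds hj', neg_mul_neg]
    exact mem_imul (mem_gradAt hL hΔ0 hΔ1 hf hla hlb hchk hj h1 h2) (mem_gradAt hL hΔ0 hΔ1 hf hla hlb hchk hj' h1 h2)
  · have hR : ¬ IsReg L ((((r1 : ℕ) : ZMod L), ((r2 : ℕ) : ZMod L))) := fun h => hr (hreg.mpr h)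
    rw [if_neg hR]; simp only [hr]; exact mem_zero

end FinXB

end Summit.HubbardSuperconductivity.HubbardSuperconductivity.Theorems.AnisotropyChord.Transfer.Fibre3
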